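import Mathlib.Analysis.SpecialFunctions.Pow.Real
import Mathlib.Analysis.SpecialFunctions.Sqrt
import Mathlib.Algebra.BigOperators.Fin

/-!
# Pointwise Type-I bound for the quadratic coefficients of the frozen energy identity

Helper file for the line `log-lipschitz-budget` of the crux
`ImplosionDichotomy.PolynomialCompression` (stub `stub_logBudgetShadowing`, blueprint §2).

In the frozen (relative) energy identity for the difference `W = (a, w, b)` of a hard-sphere–Euler
solution `(ρ, u, θ)` and the Type-I reference implosion `(ρ₁, u₁, θ₁)` (with `ρ₁ = c₁³`,
`θ₁ = K c₁²`), the `W`-independent quadratic coefficients are built from the EOS values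
`ζ0 = ζ(ρ)`, `ζ1 = ρ ζ'(ρ)`, `ζ2 = ρ² ζ''(ρ)`, the velocity gradients `du`, `du₁` and the gradients
`dρ`, `dθ`, `dc₁`.  Under the bootstrap hypotheses (values within a factor `1/2` of the reference,
EOS values within `cZ ηh` of the ideal gas with `ηh (cZ + 1) ≤ 1/8`, Type-I gradient bounds
`≲ 1/λ`), the quadratic form is bounded by `(Λ/λ) · e` with the energy density
`e = ½ (A a² + ρ |w|² + B b²)`, `A = θ (ζ0 + ζ1)/ρ`, `B = 3ρ/(2θ)`, for a constant
`Λ = Λ(K, C, Cb)` independent of the point data; we take `Λ = 50 (C + Cb + 3 √K C)`.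

This is a pure real-number inequality (no torus, no PDE).  The proof is the usual absorption of
cross terms `c a wᵢ`, `c b wᵢ` by weighted Young inequalities with the weights `√K/c₁²` and
`1/(√K c₁)` (comparable to `√(A/ρ)` and `√(B/ρ)`), plus the observation that the Type-I sizes of
the coefficients are exactly matched by the sizes of the weights (the `c₁`-powers cancel).

Main result: `frozen_quadratic_pointwise_bound`.  The private lemmas isolate the four kinds of
terms (two diagonal, two cross) and the sizes of the coefficients.
-/

namespace Summit.AtomisticToContinuum.HydrodynamicLimit.Theorems

/-! ### Elementary absorption lemmas -/

/-- `x y ≤ P M` when `|x| ≤ P` and `|y| ≤ M`. [folklore] -/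
private theorem mul_le_of_abs_le_of_abs_le {x y P M : ℝ} (hx : |x| ≤ P) (hy : |y| ≤ M) :
    x * y ≤ P * M :=
  calc x * y ≤ |x * y| := le_abs_self _
    _ = |x| * |y| := abs_mul x y
    _ ≤ P * M := mul_le_mul hx hy (abs_nonneg _) ((abs_nonneg x).trans hx)

/-- Cross term `c·a·w` against the `a`- and `w`-energies: if `|c| ≤ 3 s c₁ G`, `s² ≤ 4 c₁ A` and
`c₁³ ≤ 2 ρ`, then `c a w ≤ G (6 A a² + 3 ρ w²)` (weighted Young with weight `s/c₁²`).
[folklore] -/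
private theorem cross_a_term {c a w s c₁ G A ρ : ℝ} (hc₁ : 0 < c₁) (hG : 0 ≤ G)
    (hc : |c| ≤ 3 * s * c₁ * G) (hA : s ^ 2 ≤ 4 * c₁ * A) (hρ : c₁ ^ 3 ≤ 2 * ρ) :
    c * a * w ≤ G * (6 * (A * a ^ 2) + 3 * (ρ * w ^ 2)) := by
  have h1 : c * a * w ≤ 3 * s * c₁ * G * (|a| * |w|) := by
    calc c * a * w = c * (a * w) := by ring
      _ ≤ |c * (a * w)| := le_abs_self _
      _ = |c| * (|a| * |w|) := by rw [abs_mul, abs_mul]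
      _ ≤ 3 * s * c₁ * G * (|a| * |w|) := mul_le_mul_of_nonneg_right hc (by positivity)
  have h2 : 2 * (s * |a|) * (c₁ ^ 2 * |w|) ≤ (s * |a|) ^ 2 + (c₁ ^ 2 * |w|) ^ 2 :=
    two_mul_le_add_sq _ _
  have h3 : (s * |a|) ^ 2 + (c₁ ^ 2 * |w|) ^ 2 = s ^ 2 * a ^ 2 + c₁ ^ 4 * w ^ 2 := by
    rw [mul_pow, mul_pow, sq_abs, sq_abs]; ring
  have ha2 : 0 ≤ a ^ 2 := sq_nonneg a
  have hw2 : 0 ≤ c₁ * w ^ 2 := by positivity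
  have hA' : s ^ 2 * a ^ 2 ≤ 4 * c₁ * A * a ^ 2 := mul_le_mul_of_nonneg_right hA ha2
  have hρ' : c₁ ^ 3 * (c₁ * w ^ 2) ≤ 2 * ρ * (c₁ * w ^ 2) := mul_le_mul_of_nonneg_right hρ hw2
  refine le_of_mul_le_mul_left ?_ hc₁
  calc c₁ * (c * a * w) ≤ c₁ * (3 * s * c₁ * G * (|a| * |w|)) :=
        mul_le_mul_of_nonneg_left h1 hc₁.le
    _ = 3 / 2 * G * (2 * (s * |a|) * (c₁ ^ 2 * |w|)) := by ring
    _ ≤ 3 / 2 * G * ((s * |a|) ^ 2 + (c₁ ^ 2 * |w|) ^ 2) :=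
        mul_le_mul_of_nonneg_left h2 (by positivity)
    _ = 3 / 2 * G * (s ^ 2 * a ^ 2 + c₁ ^ 3 * (c₁ * w ^ 2)) := by rw [h3]; ring
    _ ≤ 3 / 2 * G * (4 * c₁ * A * a ^ 2 + 2 * ρ * (c₁ * w ^ 2)) :=
        mul_le_mul_of_nonneg_left (add_le_add hA' hρ') (by positivity)
    _ = c₁ * (G * (6 * (A * a ^ 2) + 3 * (ρ * w ^ 2))) := by ring

/-- Cross term `c·b·w` against the `b`- and `w`-energies: if `s |c| ≤ (5/4) c₁² G`, `c₁ ≤ 2 s² B`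
and `c₁³ ≤ 2 ρ`, then `c b w ≤ G ((5/4) B b² + (5/4) ρ w²)` (weighted Young with weight
`1/(s c₁)`). [folklore] -/
private theorem cross_b_term {c b w s c₁ G B ρ : ℝ} (hs : 0 < s) (hc₁ : 0 < c₁) (hG : 0 ≤ G)
    (hc : s * |c| ≤ 5 / 4 * c₁ ^ 2 * G) (hB : c₁ ≤ 2 * s ^ 2 * B) (hρ : c₁ ^ 3 ≤ 2 * ρ) :
    c * b * w ≤ G * (5 / 4 * (B * b ^ 2) + 5 / 4 * (ρ * w ^ 2)) := by
  have h1 : c * b * w ≤ |c| * (|b| * |w|) := by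
    calc c * b * w = c * (b * w) := by ring
      _ ≤ |c * (b * w)| := le_abs_self _
      _ = |c| * (|b| * |w|) := by rw [abs_mul, abs_mul]
  have h2 : 2 * |b| * (s * c₁ * |w|) ≤ |b| ^ 2 + (s * c₁ * |w|) ^ 2 := two_mul_le_add_sq _ _
  have h3 : |b| ^ 2 + (s * c₁ * |w|) ^ 2 = b ^ 2 + s ^ 2 * c₁ ^ 2 * w ^ 2 := by
    rw [mul_pow, mul_pow, sq_abs, sq_abs]
  have hb2 : 0 ≤ c₁ * b ^ 2 := by positivity
  have hw2 : 0 ≤ s ^ 2 * c₁ * w ^ 2 := by positivity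
  have hB' : c₁ * (c₁ * b ^ 2) ≤ 2 * s ^ 2 * B * (c₁ * b ^ 2) := mul_le_mul_of_nonneg_right hB hb2
  have hρ' : c₁ ^ 3 * (s ^ 2 * c₁ * w ^ 2) ≤ 2 * ρ * (s ^ 2 * c₁ * w ^ 2) :=
    mul_le_mul_of_nonneg_right hρ hw2
  have hpos : 0 < 2 * s ^ 2 * c₁ := by positivity
  refine le_of_mul_le_mul_left ?_ hpos
  calc 2 * s ^ 2 * c₁ * (c * b * w) ≤ 2 * s ^ 2 * c₁ * (|c| * (|b| * |w|)) :=
        mul_le_mul_of_nonneg_left h1 hpos.le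
    _ = s * |c| * (2 * |b| * (s * c₁ * |w|)) := by ring
    _ ≤ s * |c| * (|b| ^ 2 + (s * c₁ * |w|) ^ 2) :=
        mul_le_mul_of_nonneg_left h2 (by positivity)
    _ ≤ 5 / 4 * c₁ ^ 2 * G * (|b| ^ 2 + (s * c₁ * |w|) ^ 2) :=
        mul_le_mul_of_nonneg_right hc (by positivity)
    _ = 5 / 4 * G * (c₁ * (c₁ * b ^ 2) + c₁ ^ 3 * (s ^ 2 * c₁ * w ^ 2)) := by rw [h3]; ring
    _ ≤ 5 / 4 * G * (2 * s ^ 2 * B * (c₁ * b ^ 2) + 2 * ρ * (s ^ 2 * c₁ * w ^ 2)) :=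
        mul_le_mul_of_nonneg_left (add_le_add hB' hρ') (by positivity)
    _ = 2 * s ^ 2 * c₁ * (G * (5 / 4 * (B * b ^ 2) + 5 / 4 * (ρ * w ^ 2))) := by ring

/-! ### The two diagonal terms -/

/-- Diagonal `a²`-term: the coefficient `A (2 - 2ζ0/3) - θ (2ζ1 + ζ2)/ρ` is at most `2A` in
absolute value, so against `|div u| ≤ 3G` the term is `≤ 3 G · A a²`. [folklore] -/
private theorem diag_a_term {θ ρ ζ0 ζ1 ζ2 D G a : ℝ} (hθ : 0 < θ) (hρ : 0 < ρ)
    (hζ0 : |ζ0 - 1| ≤ 1 / 8) (hζ1 : |ζ1| ≤ 1 / 8) (hζ2 : |ζ2| ≤ 1 / 8) (hD : |D| ≤ 3 * G) :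
    1 / 2 * ((θ * (ζ0 + ζ1) / ρ * (2 - 2 / 3 * ζ0) - θ * (2 * ζ1 + ζ2) / ρ) * D) * a ^ 2 ≤
      G * (3 * (θ * (ζ0 + ζ1) / ρ * a ^ 2)) := by
  have ht : 0 < θ / ρ := div_pos hθ hρ
  have hA : θ * (ζ0 + ζ1) / ρ = θ / ρ * (ζ0 + ζ1) := by ring
  have hT : θ * (2 * ζ1 + ζ2) / ρ = θ / ρ * (2 * ζ1 + ζ2) := by ring
  rw [abs_le] at hζ0 hζ1 hζ2
  have hγ : 3 / 4 ≤ ζ0 + ζ1 := by linarith [hζ0.1, hζ1.1]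
  have hA0 : 0 ≤ θ * (ζ0 + ζ1) / ρ := by rw [hA]; exact mul_nonneg ht.le (by linarith)
  have hX : |θ * (ζ0 + ζ1) / ρ * (2 - 2 / 3 * ζ0) - θ * (2 * ζ1 + ζ2) / ρ| ≤
      2 * (θ * (ζ0 + ζ1) / ρ) := by
    calc |θ * (ζ0 + ζ1) / ρ * (2 - 2 / 3 * ζ0) - θ * (2 * ζ1 + ζ2) / ρ|
          ≤ |θ * (ζ0 + ζ1) / ρ * (2 - 2 / 3 * ζ0)| + |θ * (2 * ζ1 + ζ2) / ρ| := abs_sub _ _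
      _ = θ * (ζ0 + ζ1) / ρ * |2 - 2 / 3 * ζ0| + θ / ρ * |2 * ζ1 + ζ2| := by
          rw [abs_mul, abs_of_nonneg hA0, hT, abs_mul, abs_of_pos ht]
      _ ≤ θ * (ζ0 + ζ1) / ρ * (3 / 2) + θ / ρ * (3 / 8) := by
          gcongr
          · rw [abs_le]; constructor <;> linarith [hζ0.1, hζ0.2]
          · rw [abs_le]; constructor <;> linarith [hζ1.1, hζ1.2, hζ2.1, hζ2.2]
      _ ≤ 2 * (θ * (ζ0 + ζ1) / ρ) := by
          rw [hA]; nlinarith [mul_nonneg ht.le (sub_nonneg.mpr hγ)]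
  have h1 := mul_le_of_abs_le_of_abs_le hX hD
  have ha2 : 0 ≤ a ^ 2 := sq_nonneg a
  calc 1 / 2 * ((θ * (ζ0 + ζ1) / ρ * (2 - 2 / 3 * ζ0) - θ * (2 * ζ1 + ζ2) / ρ) * D) * a ^ 2
        ≤ 1 / 2 * (2 * (θ * (ζ0 + ζ1) / ρ) * (3 * G)) * a ^ 2 :=
        mul_le_mul_of_nonneg_right (mul_le_mul_of_nonneg_left h1 (by norm_num)) ha2
    _ = G * (3 * (θ * (ζ0 + ζ1) / ρ * a ^ 2)) := by ring

/-- Diagonal `b²`-term: `|2ζ0/3| ≤ 3/4`, so against `|div u| ≤ 3G` the term is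
`≤ (9/8) G · B b²`. [folklore] -/
private theorem diag_b_term {θ ρ ζ0 D G b : ℝ} (hθ : 0 < θ) (hρ : 0 < ρ)
    (hζ0 : |ζ0 - 1| ≤ 1 / 8) (hD : |D| ≤ 3 * G) :
    1 / 2 * (2 / 3 * ζ0 * (3 / 2 * ρ / θ) * D) * b ^ 2 ≤ G * (9 / 8 * (3 / 2 * ρ / θ * b ^ 2)) := by
  have hB : 0 < 3 / 2 * ρ / θ := by positivity
  have hX : |2 / 3 * ζ0 * (3 / 2 * ρ / θ)| ≤ 3 / 4 * (3 / 2 * ρ / θ) := by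
    rw [abs_mul, abs_of_pos hB]
    refine mul_le_mul_of_nonneg_right ?_ hB.le
    rw [abs_le] at hζ0 ⊢; constructor <;> linarith [hζ0.1, hζ0.2]
  have h1 := mul_le_of_abs_le_of_abs_le hX hD
  have hb2 : 0 ≤ b ^ 2 := sq_nonneg b
  calc 1 / 2 * (2 / 3 * ζ0 * (3 / 2 * ρ / θ) * D) * b ^ 2
        ≤ 1 / 2 * (3 / 4 * (3 / 2 * ρ / θ) * (3 * G)) * b ^ 2 :=
        mul_le_mul_of_nonneg_right (mul_le_mul_of_nonneg_left h1 (by norm_num)) hb2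
    _ = G * (9 / 8 * (3 / 2 * ρ / θ * b ^ 2)) := by ring

/-! ### Sizes of the cross coefficients -/

/-- Size of the `a·w` cross coefficient `dθ γ + θ (2ζ1 + ζ2)/ρ · dρ`: with `|dθ| ≤ s c₁ G`,
`s |dρ| ≤ c₁² G`, `θ/ρ ≤ 3 s²/c₁`, `γ ≤ 5/4` and `|2ζ1 + ζ2| ≤ 3/8` it is `≤ 3 s c₁ G`.
[folklore] -/
private theorem coeff_a_bound {θ ρ ζ0 ζ1 ζ2 dθ dρ s c₁ G : ℝ} (hθ : 0 < θ) (hρ : 0 < ρ)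
    (hs : 0 < s) (hc₁ : 0 < c₁) (hG : 0 ≤ G) (ht : θ / ρ ≤ 3 * s ^ 2 / c₁)
    (hγ0 : 0 ≤ ζ0 + ζ1) (hγ1 : ζ0 + ζ1 ≤ 5 / 4) (hμ : |2 * ζ1 + ζ2| ≤ 3 / 8)
    (hdθ : |dθ| ≤ s * c₁ * G) (hdρ : s * |dρ| ≤ c₁ ^ 2 * G) :
    |dθ * (ζ0 + ζ1) + θ * (2 * ζ1 + ζ2) / ρ * dρ| ≤ 3 * s * c₁ * G := by
  have htpos : 0 < θ / ρ := div_pos hθ hρ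
  have hT : θ * (2 * ζ1 + ζ2) / ρ = θ / ρ * (2 * ζ1 + ζ2) := by ring
  have h1 : |dθ * (ζ0 + ζ1)| ≤ s * c₁ * G * (5 / 4) := by
    rw [abs_mul, abs_of_nonneg hγ0]
    exact mul_le_mul hdθ hγ1 hγ0 (by positivity)
  have h2 : θ / ρ * |dρ| ≤ 3 * s * c₁ * G := by
    calc θ / ρ * |dρ| ≤ 3 * s ^ 2 / c₁ * |dρ| := mul_le_mul_of_nonneg_right ht (abs_nonneg _)
      _ = 3 * s / c₁ * (s * |dρ|) := by ring
      _ ≤ 3 * s / c₁ * (c₁ ^ 2 * G) := mul_le_mul_of_nonneg_left hdρ (by positivity)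
      _ = 3 * s * c₁ * G := by field_simp
  have h3 : |θ * (2 * ζ1 + ζ2) / ρ * dρ| ≤ 3 / 8 * (3 * s * c₁ * G) := by
    rw [hT, abs_mul, abs_mul, abs_of_pos htpos]
    calc θ / ρ * |2 * ζ1 + ζ2| * |dρ| = |2 * ζ1 + ζ2| * (θ / ρ * |dρ|) := by ring
      _ ≤ 3 / 8 * (3 * s * c₁ * G) := mul_le_mul hμ h2 (by positivity) (by norm_num)
  have h4 : 0 ≤ s * c₁ * G := by positivity
  calc |dθ * (ζ0 + ζ1) + θ * (2 * ζ1 + ζ2) / ρ * dρ|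
        ≤ |dθ * (ζ0 + ζ1)| + |θ * (2 * ζ1 + ζ2) / ρ * dρ| := abs_add_le _ _
    _ ≤ s * c₁ * G * (5 / 4) + 3 / 8 * (3 * s * c₁ * G) := add_le_add h1 h3
    _ ≤ 3 * s * c₁ * G := by nlinarith [h4]

/-- Size of the `b·w` cross coefficient `γ dρ`: with `s |dρ| ≤ c₁² G` and `0 ≤ γ ≤ 5/4`,
`s |γ dρ| ≤ (5/4) c₁² G`. [folklore] -/
private theorem coeff_b_bound {ζ0 ζ1 dρ s c₁ G : ℝ} (hs : 0 < s)
    (hγ0 : 0 ≤ ζ0 + ζ1) (hγ1 : ζ0 + ζ1 ≤ 5 / 4) (hdρ : s * |dρ| ≤ c₁ ^ 2 * G) :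
    s * |(ζ0 + ζ1) * dρ| ≤ 5 / 4 * c₁ ^ 2 * G := by
  rw [abs_mul, abs_of_nonneg hγ0]
  calc s * ((ζ0 + ζ1) * |dρ|) = (ζ0 + ζ1) * (s * |dρ|) := by ring
    _ ≤ 5 / 4 * (c₁ ^ 2 * G) := mul_le_mul hγ1 hdρ (by positivity) (by norm_num)
    _ = 5 / 4 * c₁ ^ 2 * G := by ring

/-! ### The pointwise bound -/

/-- **Type-I bound of the quadratic coefficients of the frozen energy identity.**  Given the
ideal-gas constant `K > 0`, the Type-I constant `C ≥ 0` of the reference implosion, the bootstrap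
constant `Cb ≥ 0` and the EOS constant `cZ ≥ 0`, there is `Λ ≥ 0` (here `50 (C + Cb + 3 √K C)`)
such that at every space-time point where the bootstrap hypotheses hold — reference scale
`c₁ > 0` (`ρ₁ = c₁³`, `θ₁ = K c₁²`), solution values `ρ, θ` within half of the reference ones,
EOS values `ζ0, ζ1, ζ2` within `cZ ηh` of `(1, 0, 0)` with `ηh (cZ + 1) ≤ 1/8`, velocity
gradients `du₁` (reference, `≤ C/λ`) and `du` (`du - du₁ ≤ Cb/λ`), reference gradient `dc₁ ≤ C/λ`,
and solution gradients `dρ, dθ` controlled relative to `3c₁² dc₁, 2Kc₁ dc₁` in the weighted way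
written — the `W`-independent quadratic form of the frozen energy identity evaluated at
`W = (a, w, b)` is at most `(Λ/λ) · ½ (θ(ζ0+ζ1)/ρ · a² + ρ Σ wᵢ² + (3ρ/(2θ)) b²)`. [folklore] -/
theorem frozen_quadratic_pointwise_bound :
    ∀ (K C Cb cZ : ℝ), 0 < K → 0 ≤ C → 0 ≤ Cb → 0 ≤ cZ →
      ∃ Λ : ℝ, 0 ≤ Λ ∧
        ∀ (lam c₁ ρ θ ζ0 ζ1 ζ2 ηh : ℝ) (du du₁ : Fin 3 → Fin 3 → ℝ) (dc₁ dρ dθ : Fin 3 → ℝ)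
          (a b : ℝ) (w : Fin 3 → ℝ),
          0 < lam → 0 < c₁ → 0 ≤ ηh → ηh * (cZ + 1) ≤ 1 / 8 →
          |ζ0 - 1| ≤ cZ * ηh → |ζ1| ≤ cZ * ηh → |ζ2| ≤ cZ * ηh →
          |ρ - c₁ ^ 3| ≤ c₁ ^ 3 / 2 → |θ - K * c₁ ^ 2| ≤ K * c₁ ^ 2 / 2 →
          (∀ i j, |du₁ i j| ≤ C / lam) → (∀ i j, |du i j - du₁ i j| ≤ Cb / lam) →
          (∀ i, |dc₁ i| ≤ C / lam) →
          (∀ i, Real.sqrt K * c₁ * |dρ i - 3 * c₁ ^ 2 * dc₁ i| / c₁ ^ 3 ≤ Cb / lam) →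
          (∀ i, |dθ i - 2 * K * c₁ * dc₁ i| / (Real.sqrt K * c₁) ≤ Cb / lam) →
          (1 / 2 * ((θ * (ζ0 + ζ1) / ρ * (2 - 2 / 3 * ζ0) - θ * (2 * ζ1 + ζ2) / ρ) *
              ∑ i, du i i) * a ^ 2 +
            1 / 2 * (2 / 3 * ζ0 * (3 / 2 * ρ / θ) * ∑ i, du i i) * b ^ 2 +
            ∑ i, (dθ i * (ζ0 + ζ1) + θ * (2 * ζ1 + ζ2) / ρ * dρ i) * a * w i +
            ∑ i, (ζ0 + ζ1) * dρ i * b * w i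
            ≤ Λ / lam *
              (1 / 2 * (θ * (ζ0 + ζ1) / ρ * a ^ 2 + ρ * ∑ i, w i ^ 2 + 3 / 2 * ρ / θ * b ^ 2))) :=
    by
  intro K C Cb cZ hK hC hCb hcZ
  refine ⟨50 * (C + Cb + 3 * Real.sqrt K * C), by positivity, ?_⟩
  intro lam c₁ ρ θ ζ0 ζ1 ζ2 ηh du du₁ dc₁ dρ dθ a b w hlam hc₁ hηh hηcZ hζ0 hζ1 hζ2 hρ hθ hdu₁ hdu
    hdc₁ hdρ hdθ
  -- `s = √K`, and `K = s²` everywhere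
  have hs : 0 < Real.sqrt K := Real.sqrt_pos.mpr hK
  have hsq : Real.sqrt K ^ 2 = K := Real.sq_sqrt hK.le
  generalize Real.sqrt K = s at hs hsq hdρ hdθ ⊢
  subst hsq
  -- `L = 1/lam`
  obtain ⟨L, hL, hLlam⟩ : ∃ L : ℝ, 0 < L ∧ ∀ X : ℝ, X / lam = X * L :=
    ⟨1 / lam, by positivity, fun X => by rw [mul_one_div]⟩
  simp only [hLlam] at hdu₁ hdu hdc₁ hdρ hdθ ⊢
  -- the universal Type-I size `G = (C + Cb + 3 s C) L`
  obtain ⟨G, hGdef⟩ : ∃ G : ℝ, (C + Cb + 3 * s * C) * L = G := ⟨_, rfl⟩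
  have hG : 0 ≤ G := by rw [← hGdef]; positivity
  rw [show (50 : ℝ) * (C + Cb + 3 * s * C) * L = 50 * G by rw [← hGdef]; ring]
  -- smallness of the EOS deviations
  have hsmall : cZ * ηh ≤ 1 / 8 := by linarith
  have hζ0' : |ζ0 - 1| ≤ 1 / 8 := hζ0.trans hsmall
  have hζ1' : |ζ1| ≤ 1 / 8 := hζ1.trans hsmall
  have hζ2' : |ζ2| ≤ 1 / 8 := hζ2.trans hsmall
  have hγ0 : 3 / 4 ≤ ζ0 + ζ1 := by linarith [(abs_le.mp hζ0').1, (abs_le.mp hζ1').1]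
  have hγ1 : ζ0 + ζ1 ≤ 5 / 4 := by linarith [(abs_le.mp hζ0').2, (abs_le.mp hζ1').2]
  have hμ : |2 * ζ1 + ζ2| ≤ 3 / 8 := by
    rw [abs_le] at hζ1' hζ2' ⊢; constructor <;> linarith [hζ1'.1, hζ1'.2, hζ2'.1, hζ2'.2]
  -- the bootstrap windows for `ρ` and `θ`
  have hρlo : c₁ ^ 3 / 2 ≤ ρ := by linarith [(abs_le.mp hρ).1]
  have hρup : ρ ≤ 3 * c₁ ^ 3 / 2 := by linarith [(abs_le.mp hρ).2]
  have hθlo : s ^ 2 * c₁ ^ 2 / 2 ≤ θ := by linarith [(abs_le.mp hθ).1]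
  have hθup : θ ≤ 3 / 2 * s ^ 2 * c₁ ^ 2 := by linarith [(abs_le.mp hθ).2]
  have hc3 : 0 < c₁ ^ 3 := by positivity
  have hsc : 0 < s ^ 2 * c₁ ^ 2 := by positivity
  have hρpos : 0 < ρ := by linarith
  have hθpos : 0 < θ := by linarith
  have hρ2 : c₁ ^ 3 ≤ 2 * ρ := by linarith
  -- comparison of the weights with the reference scales
  have ht : θ / ρ ≤ 3 * s ^ 2 / c₁ := by
    rw [div_le_div_iff₀ hρpos hc₁]
    have e1 : θ * c₁ ≤ 3 / 2 * s ^ 2 * c₁ ^ 2 * c₁ := mul_le_mul_of_nonneg_right hθup hc₁.le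
    have e2 : 3 * s ^ 2 * (c₁ ^ 3 / 2) ≤ 3 * s ^ 2 * ρ :=
      mul_le_mul_of_nonneg_left hρlo (by positivity)
    linarith
  have hAlow : s ^ 2 ≤ 4 * c₁ * (θ * (ζ0 + ζ1) / ρ) := by
    rw [show 4 * c₁ * (θ * (ζ0 + ζ1) / ρ) = 4 * c₁ * θ * (ζ0 + ζ1) / ρ by ring,
      le_div_iff₀ hρpos]
    have e1 : s ^ 2 * ρ ≤ s ^ 2 * (3 * c₁ ^ 3 / 2) := mul_le_mul_of_nonneg_left hρup (sq_nonneg s)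
    have e2 : 3 * c₁ * (s ^ 2 * c₁ ^ 2 / 2) ≤ 3 * c₁ * θ :=
      mul_le_mul_of_nonneg_left hθlo (by positivity)
    have e3 : 4 * c₁ * θ * (3 / 4) ≤ 4 * c₁ * θ * (ζ0 + ζ1) :=
      mul_le_mul_of_nonneg_left hγ0 (by positivity)
    linarith
  have hBlow : c₁ ≤ 2 * s ^ 2 * (3 / 2 * ρ / θ) := by
    rw [show 2 * s ^ 2 * (3 / 2 * ρ / θ) = 3 * s ^ 2 * ρ / θ by ring, le_div_iff₀ hθpos]
    have e1 : c₁ * θ ≤ c₁ * (3 / 2 * s ^ 2 * c₁ ^ 2) := mul_le_mul_of_nonneg_left hθup hc₁.le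
    have e2 : 3 * s ^ 2 * (c₁ ^ 3 / 2) ≤ 3 * s ^ 2 * ρ :=
      mul_le_mul_of_nonneg_left hρlo (by positivity)
    linarith
  -- Type-I sizes of the coefficients
  have hdiag : ∀ i, |du i i| ≤ G := fun i => by
    have h1 := abs_add_le (du i i - du₁ i i) (du₁ i i)
    rw [sub_add_cancel] at h1
    have h2 : 0 ≤ 3 * s * C * L := by positivity
    rw [← hGdef]; linarith [hdu i i, hdu₁ i i]
  have hD : |du 0 0 + du 1 1 + du 2 2| ≤ 3 * G := by
    linarith [abs_add_three (du 0 0) (du 1 1) (du 2 2), hdiag 0, hdiag 1, hdiag 2]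
  have hdθ' : ∀ i, |dθ i| ≤ s * c₁ * G := fun i => by
    have h1 : |dθ i - 2 * s ^ 2 * c₁ * dc₁ i| ≤ Cb * L * (s * c₁) :=
      (div_le_iff₀ (by positivity)).mp (hdθ i)
    have h2 := abs_add_le (dθ i - 2 * s ^ 2 * c₁ * dc₁ i) (2 * s ^ 2 * c₁ * dc₁ i)
    rw [sub_add_cancel, abs_mul, abs_of_pos (by positivity : (0 : ℝ) < 2 * s ^ 2 * c₁)] at h2
    have h3 : 2 * s ^ 2 * c₁ * |dc₁ i| ≤ 2 * s ^ 2 * c₁ * (C * L) :=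
      mul_le_mul_of_nonneg_left (hdc₁ i) (by positivity)
    have h4 : 0 ≤ s * c₁ * C * L := by positivity
    have h5 : 0 ≤ s ^ 2 * c₁ * C * L := by positivity
    rw [← hGdef]; linarith
  have hdρ' : ∀ i, s * |dρ i| ≤ c₁ ^ 2 * G := fun i => by
    have h1 : s * c₁ * |dρ i - 3 * c₁ ^ 2 * dc₁ i| ≤ Cb * L * c₁ ^ 3 :=
      (div_le_iff₀ hc3).mp (hdρ i)
    have h1' : s * |dρ i - 3 * c₁ ^ 2 * dc₁ i| ≤ Cb * L * c₁ ^ 2 := by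
      refine le_of_mul_le_mul_left ?_ hc₁
      calc c₁ * (s * |dρ i - 3 * c₁ ^ 2 * dc₁ i|) = s * c₁ * |dρ i - 3 * c₁ ^ 2 * dc₁ i| := by
            ring
        _ ≤ Cb * L * c₁ ^ 3 := h1
        _ = c₁ * (Cb * L * c₁ ^ 2) := by ring
    have h2 := abs_add_le (dρ i - 3 * c₁ ^ 2 * dc₁ i) (3 * c₁ ^ 2 * dc₁ i)
    rw [sub_add_cancel, abs_mul, abs_of_pos (by positivity : (0 : ℝ) < 3 * c₁ ^ 2)] at h2
    have h2' := mul_le_mul_of_nonneg_left h2 hs.le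
    have h3 : s * (3 * c₁ ^ 2 * |dc₁ i|) ≤ s * (3 * c₁ ^ 2 * (C * L)) :=
      mul_le_mul_of_nonneg_left (mul_le_mul_of_nonneg_left (hdc₁ i) (by positivity)) hs.le
    have h4 : 0 ≤ c₁ ^ 2 * C * L := by positivity
    rw [← hGdef]; linarith
  -- the four groups of terms
  have T1 := diag_a_term (a := a) hθpos hρpos hζ0' hζ1' hζ2' hD
  have T2 := diag_b_term (b := b) hθpos hρpos hζ0' hD
  have T3 : ∀ i, (dθ i * (ζ0 + ζ1) + θ * (2 * ζ1 + ζ2) / ρ * dρ i) * a * w i ≤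
      G * (6 * (θ * (ζ0 + ζ1) / ρ * a ^ 2) + 3 * (ρ * w i ^ 2)) := fun i =>
    cross_a_term hc₁ hG
      (coeff_a_bound hθpos hρpos hs hc₁ hG ht (by linarith) hγ1 hμ (hdθ' i) (hdρ' i)) hAlow hρ2
  have T4 : ∀ i, (ζ0 + ζ1) * dρ i * b * w i ≤
      G * (5 / 4 * (3 / 2 * ρ / θ * b ^ 2) + 5 / 4 * (ρ * w i ^ 2)) := fun i =>
    cross_b_term hs hc₁ hG (coeff_b_bound hs (by linarith) hγ1 (hdρ' i)) hBlow hρ2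
  -- nonnegativity of the energy pieces, and assembly
  have hApos : 0 ≤ θ * (ζ0 + ζ1) / ρ := div_nonneg (mul_nonneg hθpos.le (by linarith)) hρpos.le
  have hA0 : 0 ≤ G * (θ * (ζ0 + ζ1) / ρ * a ^ 2) := mul_nonneg hG (mul_nonneg hApos (sq_nonneg a))
  have hB0 : 0 ≤ G * (3 / 2 * ρ / θ * b ^ 2) := by positivity
  have hW : ∀ i, 0 ≤ G * (ρ * w i ^ 2) := fun i => by positivity
  simp only [Fin.sum_univ_three]
  linarith [T1, T2, T3 0, T3 1, T3 2, T4 0, T4 1, T4 2, hA0, hB0, hW 0, hW 1, hW 2]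

end Summit.AtomisticToContinuum.HydrodynamicLimit.Theorems
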